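import Summits.HodgeConjecture.HodgeConjecture.Theorems.Ring2AbelianAllNonsplitNormObstruction
import HarnessLib

/-!
# The Weil surfaces of the non-split class carry a DIVISION quaternion algebra: the norm form `⟨1, 3, -2, -6⟩`
# of `(-3, 2)_ℚ` is anisotropic (WEIL-2 gen 18, door (h-Σ))

research route, not a corollary; conditional on HC_CM plus one named minimal statement.

Cell `pub-hodge-ring2-ab-*` (ALL ABELIAN VARIETIES), seat WEIL-2 gen 18, §3.4 of
`run/shared/lean/pub/pub-hodge-ring2/pub-hodge-ring2-ab-weil-2/DOOR-SIGMA-G18.md`.  The decomposable members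
`A₂ × Z₄` of the non-split `(ℚ(√-3), (3,3))` Weil component `NonsplitSixfolds[ℚ(√-3), -2]` with `Z₄` a SPLIT Weil
fourfold (the component of Schoen's and Markman's fourfold anchors) have as `(1,1)` factor a Weil surface `A₂` whose
binary `K`-hermitian form is `⟨1, -2⟩` (discriminant class `[-2]`, e.g. `E_ω × Ē_ω` with polarization type `(1,2)`).
The special unitary group of `⟨1,-2⟩` is the norm-one group of the quaternion algebra `D = (-3, 2)_ℚ`, whose norm form
is `Tr_{K/ℚ}⟨1,-2⟩ = ⟨1, 3, -2, -6⟩`.  This file proves that this quadratic form represents zero only trivially over `ℚ`,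
i.e. that `D` is a DIVISION algebra (it is the indefinite quaternion algebra of discriminant `6`, ramified at `2` and
`3`): consequently (Shimura; van Geemen LNM 1594 §5 — cited in the account, not re-proved here) the `(1,1)` Weil surfaces
of class `[-2]` are abelian surfaces with quaternionic multiplication by an order of `D`, their Shimura curve is COMPACT,
and the very general member is SIMPLE with `NS ⊗ ℚ = ℚω ⊕ W_K` of rank `3` — the facts used by LEMMA μ / LEMMA OH of the
gen-18 account (door (h-Σ): anchors of the form Schoen surface × Weil curve).  The whole proof is the reduction
`x² + 3y² = 2(z² + 3w²), (z,w) ≠ 0 ⟹ 2 ∈ Nm(ℚ(√-3)ˣ)` by the composition identity of the norm form `a² + 3b²`,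
followed by the gen-17 theorem `not_exists_sq_add_three_sq_eq_two` (p301193).

## What is proved (0 sorry, no `def`, no named fact; `HC_CM` does not occur)

* `norm3_comp_identity` — `(xz + 3yw)² + 3(yz - xw)² = (x² + 3y²)(z² + 3w²)`.
* `sq_add_three_sq_eq_zero_iff` — over `ℚ`, `z² + 3w² = 0 ↔ z = 0 ∧ w = 0`.
* `norm3_ne_two_mul_norm3` — `x² + 3y² = 2(z² + 3w²)` forces `x = y = z = w = 0`
  (the binary `ℚ(√-3)`-hermitian form `⟨1, -2⟩` is anisotropic: `Nm(u) = 2·Nm(v) ⟹ u = v = 0`).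
* `normForm_D6_anisotropic` — `x² + 3y² - 2z² - 6w² = 0 ⟹ x = y = z = w = 0`
  (the norm form of `(-3,2)_ℚ` is anisotropic: `(-3,2)_ℚ` is a division algebra).
* `normForm_D6_ne_zero` — the same, as `≠ 0` off the origin.

## References

* [vanGeemen1994HodgeAV] B. van Geemen, An introduction to the Hodge conjecture for abelian varieties, LNM 1594
  (1994), 4.14, (5.4.1), §5 (Weil surfaces and quaternion algebras).
* [Shimura1963AnalyticFamilies] G. Shimura, On analytic families of polarized abelian varieties and automorphic
  functions, Ann. of Math. 78 (1963) — abelian surfaces with imaginary-quadratic (1,1) action; cited for context only.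
-/

namespace Summit.HodgeConjecture.Ring2AbelianAll.NonsplitWeilSurfaceQuaternion

open Summit.HodgeConjecture.Ring2AbelianAll.NonsplitNormObstruction

/-- **Composition identity of the norm form `a² + 3b²` of `ℚ(√-3)`**: `Nm(u·v̄) = Nm(u)·Nm(v)` written out for
`u = x + y√-3`, `v = z + w√-3`.
research route, not a corollary; conditional on HC_CM plus one named minimal statement. [folklore] -/
theorem norm3_comp_identity (x y z w : ℚ) :
    (x * z + 3 * y * w) ^ 2 + 3 * (y * z - x * w) ^ 2 = (x ^ 2 + 3 * y ^ 2) * (z ^ 2 + 3 * w ^ 2) := by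
  ring

/-- Over `ℚ`, `z² + 3w² = 0` only for `z = w = 0` (positivity).
research route, not a corollary; conditional on HC_CM plus one named minimal statement. [folklore] -/
theorem sq_add_three_sq_eq_zero_iff (z w : ℚ) : z ^ 2 + 3 * w ^ 2 = 0 ↔ z = 0 ∧ w = 0 := by
  constructor
  · intro h
    have hz : z ^ 2 = 0 := by nlinarith [sq_nonneg z, sq_nonneg w]
    have hw : w ^ 2 = 0 := by nlinarith [sq_nonneg z, sq_nonneg w]
    exact ⟨pow_eq_zero_iff (n := 2) (by norm_num) |>.1 hz, pow_eq_zero_iff (n := 2) (by norm_num) |>.1 hw⟩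
  · rintro ⟨rfl, rfl⟩
    norm_num

/-- **The binary `ℚ(√-3)`-hermitian form `⟨1, -2⟩` is anisotropic**: `Nm(x + y√-3) = 2·Nm(z + w√-3)` forces
`x = y = z = w = 0`.  If `(z, w) ≠ 0`, dividing `u·v̄` by `Nm(v)` produces `a, b ∈ ℚ` with `a² + 3b² = 2`, contradicting
`not_exists_sq_add_three_sq_eq_two` (gen 17, p301193: `2 ∉ Nm(ℚ(√-3)ˣ)`).
research route, not a corollary; conditional on HC_CM plus one named minimal statement. [cite: vanGeemen1994HodgeAV, (5.4.1)] -/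
theorem norm3_ne_two_mul_norm3 (x y z w : ℚ) (h : x ^ 2 + 3 * y ^ 2 = 2 * (z ^ 2 + 3 * w ^ 2)) :
    x = 0 ∧ y = 0 ∧ z = 0 ∧ w = 0 := by
  by_cases hN : z ^ 2 + 3 * w ^ 2 = 0
  · obtain ⟨rfl, rfl⟩ := (sq_add_three_sq_eq_zero_iff z w).1 hN
    have hxy : x ^ 2 + 3 * y ^ 2 = 0 := by rw [h]; norm_num
    obtain ⟨rfl, rfl⟩ := (sq_add_three_sq_eq_zero_iff x y).1 hxy
    exact ⟨rfl, rfl, rfl, rfl⟩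
  · exfalso
    apply not_exists_sq_add_three_sq_eq_two
    refine ⟨(x * z + 3 * y * w) / (z ^ 2 + 3 * w ^ 2), (y * z - x * w) / (z ^ 2 + 3 * w ^ 2), ?_⟩
    have hid := norm3_comp_identity x y z w
    have hN' : z ^ 2 + 3 * w ^ 2 ≠ 0 := hN
    field_simp
    linear_combination hid + (z ^ 2 + 3 * w ^ 2) * h

/-- **The norm form `⟨1, 3, -2, -6⟩` of the quaternion algebra `(-3, 2)_ℚ` is anisotropic over `ℚ`**:
`x² + 3y² - 2z² - 6w² = 0 ⟹ x = y = z = w = 0`.  Equivalently `(-3,2)_ℚ` — the indefinite quaternion algebra of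
discriminant `6` — is a DIVISION algebra, and `SU⟨1,-2⟩_{ℚ(√-3)} = SL₁(D)` is ℚ-anisotropic: the Shimura curve of
the `(1,1)` Weil surfaces of class `[-2]` is compact.
research route, not a corollary; conditional on HC_CM plus one named minimal statement. [cite: vanGeemen1994HodgeAV, (5.4.1)] -/
theorem normForm_D6_anisotropic (x y z w : ℚ) (h : x ^ 2 + 3 * y ^ 2 - 2 * z ^ 2 - 6 * w ^ 2 = 0) :
    x = 0 ∧ y = 0 ∧ z = 0 ∧ w = 0 :=
  norm3_ne_two_mul_norm3 x y z w (by linear_combination h)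

/-- Contrapositive packaging: off the origin the norm form of `(-3,2)_ℚ` does not vanish.
research route, not a corollary; conditional on HC_CM plus one named minimal statement. [folklore] -/
theorem normForm_D6_ne_zero (x y z w : ℚ) (h : ¬ (x = 0 ∧ y = 0 ∧ z = 0 ∧ w = 0)) :
    x ^ 2 + 3 * y ^ 2 - 2 * z ^ 2 - 6 * w ^ 2 ≠ 0 :=
  fun h0 => h (normForm_D6_anisotropic x y z w h0)

end Summit.HodgeConjecture.Ring2AbelianAll.NonsplitWeilSurfaceQuaternion
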